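import Literature.NumberTheory.LFunctions.Zhang2022.Section12Eq1216Edge

/-!
# Zhang (2022) §12: the leaf (12.16) from the EXACT-weight reading of the p. 73 top range — `Eq1216 ⇐ Low1522 ∧ (u049 with 𝔴*_j exact)`

Topic `Literature/NumberTheory/LFunctions/Zhang2022` (Landau–Siegel audit tree; verdict-neutral).
Y. Zhang, *Discrete mean estimates and the Landau–Siegel zero*, arXiv:2211.02515v1 (2022)
[Zhang2022LandauSiegel]. **Status of the source: an unrefereed manuscript under adjudication**; everything in this
file is PROVED (theorems only; no new definitions, no new facts); nothing here is a claim about Theorems 1–2 of the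
source or about Landau–Siegel zeros.

Companion of `Section12Eq1216Edge.lean`. There the leaf `Typed.Sec12C.Eq1216 c′` ((12.16), p. 73) was derived from the two
p. 73 range claims with the top range read LINEARLY (`Step12u049`: weight `𝓦*⁰_j` plus the `10⁻⁵` slack of Lemma 12.1's
printed pointwise bound, which the kernel refutes — `Numerics.not_lemma121Pointwise_num_*`). Here the top range is read
with Zhang's OWN EXACT weight of the proof of Lemma 12.1 (p. 68, §12.u020: `𝔴*_j(y) = (y/P″₁)^{−β₆}(−1 + (β₆ − β_j)
log(y/P″₁))`, no `ε₁ⱼ`, no slack), i.e. the reading of record after the lane's re-type RT-02: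

* `exact_weight_bound`, **`wStarEx_sub_wStarExact_le`** — the `D`-dependent exact weight at `y = P^z` is within `10⁻⁵`
  of its main value `Numerics.wStarExact j z = −e^{−3πiu/2}(1 − (3/2 − j)πiu)` (`u = z − 0.496`) on `[0.496, 0.5]` for
  `D ≥ D₀(c′)`: `(P^z/P″₁)^{−β₆} = e^{−3πiu/2}·e^{iθ}`, `θ = (3/2)α log(Dt₀) ≤ 780π𝓛⁻⁸`, and `(β₆ − β_j)log(P^z/P″₁) =
  (3/2 − j)πiu + O((1+|c′|)𝓛⁻⁸)` ((2.13), (2.22), `α log P = π`);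
* `norm_e2starBarW_exact_sub_lt` — the kernel enclosure of the six EXACT `𝔤𝔥`-window integrals against `conj e₂*`,
  sharpened to `3.3·10⁻⁶` on the tree box `Numerics.E16x` (`NumericsSection12ExactB.mem_E16x`; value `3.227·10⁻⁶`);
* **`eq1216_of_low1522_of_topEx`** — (12.16) from `Low1522 c′` and ANY top-range evaluation of the printed u049 shape
  whose weight family `w_D(j, ·)` is, for all large `D`, continuous and within `10⁻⁵` of `wStarExact` on the window
  (budget `3.3·10⁻⁶ + 10⁻⁵·0.055 ≤ 5·10⁻⁶` = the typed "`ε/2`");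
* **`eq1216_of_low1522_top1522Ex_shape`** — the instance for the exact weight written as in §12.u020
  (`((y/P″₁ : ℝ) : ℂ)^(−β₆)·(−1 + (β₆ − β_j)·log(y/P″₁))` inside the prefactors of `main12u049int`): this is the
  hypothesis shape of the lane's re-typed top-range node for `S_j(𝐚₁₅,𝐚₂₂)` (exact weight, `o(α)`), so the leaf
  `h1216` of `theorem1_of_leaves` becomes a theorem of the leaves `hLow` and that node.

## References

* Y. Zhang, arXiv:2211.02515v1 (2022), §12 p. 68 (proof of Lemma 12.1, u020), p. 73 (u049, (12.16)); §2 (2.10),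
  (2.13), (2.22). [cite: Zhang2022LandauSiegel, §12 (12.16) p.73]
-/

noncomputable section

open Complex Real ComplexConjugate
open Literature.NumberTheory.LFunctions.Zhang2022
open Literature.NumberTheory.LFunctions.Zhang2022.Skeleton
open Literature.NumberTheory.LFunctions.Zhang2022.Typed.Sec12A
open Literature.NumberTheory.LFunctions.Zhang2022.Typed.Sec12C
open Literature.NumberTheory.LFunctions.Zhang2022.Numerics (wLin wStarExact J6 J7 ghj6 ghj7 e2starBarW E16x mem_E16x)
open Literature.Analysis.ValidatedNumerics.Numerics

namespace Literature.NumberTheory.LFunctions.Zhang2022.Sec12D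

/-! ## The kernel enclosure in the exact reading, sharpened to `3.3·10⁻⁶` -/

section Certificate

/-- The sharper comparison on the tree box `E16x` of `e2starBarW wStarExact − conj e₂*`: `normSq < (3.3·10⁻⁶)²`
(value `(3.227·10⁻⁶)²`). [cite: Zhang2022LandauSiegel, §12 (12.16) p.73] -/
theorem cert16x_sharp : ((E16x).normSqFI.hi : ℚ) < (1089/100000000000000 : ℚ) * (SC : ℚ) := by
  decide +kernel

/-- **`‖e2starBarW wStarExact − conj e₂*‖ < 3.3·10⁻⁶`**: the six EXACT-weight `𝔤𝔥`-window integrals of p. 73, weighted as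
in (12.16), reproduce `conj e₂*` to within `3.3·10⁻⁶` (kernel; value `3.227·10⁻⁶`). [cite: Zhang2022LandauSiegel, §12 (12.16) p.73] -/
theorem norm_e2starBarW_exact_sub_lt : ‖e2starBarW wStarExact - conj e2star‖ < 33 / 10 ^ 7 := by
  have h := hi_bound (CB.mem_normSqFI mem_E16x) cert16x_sharp
  rw [Complex.normSq_eq_norm_sq] at h
  have h2 : ((1089/100000000000000 : ℚ) : ℝ) = (33 / 10 ^ 7) ^ 2 := by norm_num
  rw [h2] at h
  exact lt_of_pow_lt_pow_left₀ 2 (by norm_num) h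

end Certificate

/-! ## The exact weight `(P^z/P″₁)^{−β₆}(−1 + (β₆ − β_j)log(P^z/P″₁))` against its main value -/

section ExactWeight

/-- **The exact weight of the proof of Lemma 12.1 at `y = P^z`, quantitative main value.** If
`B = iα(q + m c′α𝓛)` (`|q| ≤ 3/2`, `|m| ≤ 8`) and `K(c′)𝓛⁻⁸ ≤ δ`, then on `0.496 ≤ z ≤ 0.5`
`‖(P^z/P″₁)^{−β₆}(−1 + B log(P^z/P″₁)) + e^{−3πiu/2}(1 − qπiu)‖ ≤ δ`, `u = z − 0.496`: with `log(P^z/P″₁) = u log P − M`,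
`M = log(Dt₀) ∈ [0, 520𝓛]`, the power is `e^{−3πiu/2}e^{iθ}`, `θ = (3/2)αM ≤ 780α𝓛 = 780π𝓛⁻⁸`, and
`B log(P^z/P″₁) = qπiu + ζ`, `‖ζ‖ ≤ (0.004·8|c′|π² + 520π(3/2 + 8|c′|π))𝓛⁻⁸`.
[cite: Zhang2022LandauSiegel, §12 p.68 (proof of Lemma 12.1), (12.16) p.73] -/
theorem exact_weight_bound {c' : ℝ} {D : ℕ} (hL1 : 1 ≤ ell D) {δ : ℝ}
    (hK : (1.02 * (780 * π) + (0.004 * (8 * |c'| * π ^ 2) + 520 * π * (3 / 2 + 8 * |c'| * π))) / ell D ^ 8 ≤ δ)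
    {B : ℂ} {q m : ℝ} (key : B = I * alpha D * (q + m * c' * (alpha D * ell D)))
    (hq : |q| ≤ 3 / 2) (hm : |m| ≤ 8) :
    ∀ z ∈ Set.Icc (0.496 : ℝ) 0.5,
      ‖((bigP D ^ z / P1pp D : ℝ) : ℂ) ^ (-beta6 D) * (-1 + B * (Real.log (bigP D ^ z / P1pp D) : ℂ))
        - -(cexp (-(3 * π * I * ((z : ℂ) - 0.496) / 2)) * (1 - q * π * I * ((z : ℂ) - 0.496)))‖ ≤ δ := by
  intro z hz
  obtain ⟨hz1, hz2⟩ := hz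
  have hℓ : 0 < ell D := by linarith
  have h8 : 0 < ell D ^ 8 := pow_pos hℓ 8
  have hαℓ : alpha D * ell D = π / ell D ^ 8 := alpha_mul_ell D hL1
  have hα : 0 < alpha D := alpha_pos_of_log (D := D) hL1
  have hA : ((alpha D : ℝ) : ℂ) * (Real.log (bigP D) : ℝ) = (π : ℂ) := by
    rw [← Complex.ofReal_mul, alpha_mul_log_bigP D hL1]
  -- the argument `x = P^z/P″₁ > 0` and its logarithm `u log P − M`
  set u : ℝ := z - 0.496 with hu
  have hu0 : 0 ≤ u := by rw [hu]; linarith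
  have hu4 : u ≤ 0.004 := by rw [hu]; linarith
  set M : ℝ := ell D + 519 * Real.log (ell D) with hMdef
  have hlogℓ : 0 ≤ Real.log (ell D) := Real.log_nonneg hL1
  have hM0 : 0 ≤ M := by rw [hMdef]; nlinarith
  have hM : M ≤ 520 * ell D := by
    have : Real.log (ell D) ≤ ell D := (Real.log_le_sub_one_of_pos hℓ).trans (by linarith)
    rw [hMdef]; nlinarith
  have hx : 0 < bigP D ^ z / P1pp D := div_pos (Real.rpow_pos_of_pos (bigP_pos D) z) (P1pp_pos hL1)
  have hL : Real.log (bigP D ^ z / P1pp D) = u * Real.log (bigP D) - M := by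
    rw [log_rpow_div_P1pp hL1 z, hu, hMdef]; ring
  -- the power as a product of two phases
  set θ : ℝ := 3 / 2 * alpha D * M with hθ
  have hcpow : ((bigP D ^ z / P1pp D : ℝ) : ℂ) ^ (-beta6 D) =
      cexp (-(3 * π * I * ((z : ℂ) - 0.496) / 2)) * cexp (I * (θ : ℂ)) := by
    rw [Complex.cpow_def_of_ne_zero (Complex.ofReal_ne_zero.mpr hx.ne'), ← Complex.ofReal_log hx.le, hL,
      ← Complex.exp_add]
    congr 1
    rw [beta6, hθ, hu]
    push_cast
    linear_combination (-(3 : ℂ) / 2 * I * ((z : ℂ) - 0.496)) * hA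
  -- the second factor: `−1 + B log x = (−1 + qπiu) + ζ`
  set ζ : ℂ := I * (m * c' * (alpha D * ell D) * π * u : ℝ) - I * (alpha D * (q + m * c' * (alpha D * ell D)) * M : ℝ)
    with hζ
  have e2 : -1 + B * (Real.log (bigP D ^ z / P1pp D) : ℂ) = (-1 + q * π * I * ((z : ℂ) - 0.496)) + ζ := by
    rw [key, hL, hζ, hu]
    push_cast
    linear_combination (I * ((q : ℂ) + m * c' * (alpha D * ell D)) * ((z : ℂ) - 0.496)) * hA
  -- the difference
  set A : ℂ := -1 + q * π * I * ((z : ℂ) - 0.496) with hAdef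
  have e : ((bigP D ^ z / P1pp D : ℝ) : ℂ) ^ (-beta6 D) * (-1 + B * (Real.log (bigP D ^ z / P1pp D) : ℂ))
        - -(cexp (-(3 * π * I * ((z : ℂ) - 0.496) / 2)) * (1 - q * π * I * ((z : ℂ) - 0.496)))
      = cexp (-(3 * π * I * ((z : ℂ) - 0.496) / 2)) *
          ((cexp (I * (θ : ℂ)) - 1) * A + cexp (I * (θ : ℂ)) * ζ) := by
    rw [hcpow, e2, hAdef]; ring
  have n0 : ‖cexp (-(3 * π * I * ((z : ℂ) - 0.496) / 2))‖ = 1 := by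
    rw [show (-(3 * π * I * ((z : ℂ) - 0.496) / 2)) = ((-(3 * π * (z - 0.496) / 2) : ℝ) : ℂ) * I by
      push_cast; ring, Complex.norm_exp_ofReal_mul_I]
  have n1 : ‖cexp (I * (θ : ℂ))‖ = 1 := by rw [mul_comm, Complex.norm_exp_ofReal_mul_I]
  have n2 : ‖cexp (I * (θ : ℂ)) - 1‖ ≤ |θ| := by
    have h := Real.norm_exp_I_mul_ofReal_sub_one_le (x := θ)
    rwa [Real.norm_eq_abs] at h
  -- sizes: `‖A‖ ≤ 1.02`, `|θ| ≤ 780π𝓛⁻⁸`, `‖ζ‖ ≤ (…)𝓛⁻⁸`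
  have hπ := Real.pi_pos
  have hπ3 := Real.pi_lt_d2
  have hzabs : ‖((z : ℂ) - 0.496)‖ ≤ 0.004 := by
    have ee : ((z : ℂ) - 0.496) = ((z - 0.496 : ℝ) : ℂ) := by push_cast; ring
    rw [ee, Complex.norm_real, Real.norm_eq_abs, abs_le]
    constructor <;> linarith
  have nA : ‖A‖ ≤ 1.02 := by
    rw [hAdef]
    calc ‖-1 + (q : ℂ) * π * I * ((z : ℂ) - 0.496)‖ ≤ ‖(-1 : ℂ)‖ + ‖(q : ℂ) * π * I * ((z : ℂ) - 0.496)‖ :=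
          norm_add_le _ _
      _ = 1 + |q| * π * ‖((z : ℂ) - 0.496)‖ := by
          rw [norm_neg, norm_one, norm_mul, norm_mul, norm_mul, Complex.norm_I, mul_one, Complex.norm_real,
            Complex.norm_real, Real.norm_eq_abs, Real.norm_eq_abs, abs_of_pos hπ]
      _ ≤ 1 + 3 / 2 * π * 0.004 := by gcongr
      _ ≤ 1.02 := by nlinarith
  have nθ : |θ| ≤ 780 * π / ell D ^ 8 := by
    rw [hθ, abs_of_nonneg (by positivity)]
    calc 3 / 2 * alpha D * M ≤ 3 / 2 * alpha D * (520 * ell D) := by gcongr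
      _ = 780 * (alpha D * ell D) := by ring
      _ = 780 * π / ell D ^ 8 := by rw [hαℓ]; ring
  have hαℓπ : alpha D * ell D ≤ π := by
    rw [hαℓ]; exact div_le_self hπ.le (one_le_pow₀ hL1)
  have hαℓ0 : 0 ≤ alpha D * ell D := by positivity
  have nζ : ‖ζ‖ ≤ (0.004 * (8 * |c'| * π ^ 2) + 520 * π * (3 / 2 + 8 * |c'| * π)) / ell D ^ 8 := by
    rw [hζ]
    have t1 : ‖I * ((m * c' * (alpha D * ell D) * π * u : ℝ) : ℂ)‖ ≤ 0.004 * (8 * |c'| * π ^ 2) / ell D ^ 8 := by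
      rw [norm_mul, Complex.norm_I, one_mul, Complex.norm_real, Real.norm_eq_abs, hαℓ, abs_mul, abs_mul, abs_mul,
        abs_mul, abs_of_pos hπ, abs_of_pos (div_pos hπ h8), abs_of_nonneg hu0]
      have hx : 0 ≤ |c'| * (π / ell D ^ 8) * π := by positivity
      calc |m| * |c'| * (π / ell D ^ 8) * π * u ≤ 8 * |c'| * (π / ell D ^ 8) * π * 0.004 := by
            gcongr
        _ = 0.004 * (8 * |c'| * π ^ 2) / ell D ^ 8 := by ring
    have t2 : ‖I * ((alpha D * (q + m * c' * (alpha D * ell D)) * M : ℝ) : ℂ)‖ ≤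
        520 * π * (3 / 2 + 8 * |c'| * π) / ell D ^ 8 := by
      rw [norm_mul, Complex.norm_I, one_mul, Complex.norm_real, Real.norm_eq_abs, abs_mul, abs_mul,
        abs_of_pos hα, abs_of_nonneg hM0]
      have hq' : |q + m * c' * (alpha D * ell D)| ≤ 3 / 2 + 8 * |c'| * π := by
        calc |q + m * c' * (alpha D * ell D)| ≤ |q| + |m * c' * (alpha D * ell D)| := abs_add_le _ _
          _ = |q| + |m| * |c'| * (alpha D * ell D) := by rw [abs_mul, abs_mul, abs_of_nonneg hαℓ0]
          _ ≤ 3 / 2 + 8 * |c'| * π := by gcongr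
      calc alpha D * |q + m * c' * (alpha D * ell D)| * M
          ≤ alpha D * (3 / 2 + 8 * |c'| * π) * (520 * ell D) := by gcongr
        _ = 520 * (alpha D * ell D) * (3 / 2 + 8 * |c'| * π) := by ring
        _ = 520 * π * (3 / 2 + 8 * |c'| * π) / ell D ^ 8 := by rw [hαℓ]; ring
    calc ‖I * ((m * c' * (alpha D * ell D) * π * u : ℝ) : ℂ) -
          I * ((alpha D * (q + m * c' * (alpha D * ell D)) * M : ℝ) : ℂ)‖
        ≤ ‖I * ((m * c' * (alpha D * ell D) * π * u : ℝ) : ℂ)‖ +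
          ‖I * ((alpha D * (q + m * c' * (alpha D * ell D)) * M : ℝ) : ℂ)‖ := norm_sub_le _ _
      _ ≤ 0.004 * (8 * |c'| * π ^ 2) / ell D ^ 8 + 520 * π * (3 / 2 + 8 * |c'| * π) / ell D ^ 8 := add_le_add t1 t2
      _ = (0.004 * (8 * |c'| * π ^ 2) + 520 * π * (3 / 2 + 8 * |c'| * π)) / ell D ^ 8 := by ring
  -- assembly
  rw [e, norm_mul, n0, one_mul]
  calc ‖(cexp (I * (θ : ℂ)) - 1) * A + cexp (I * (θ : ℂ)) * ζ‖
      ≤ ‖(cexp (I * (θ : ℂ)) - 1) * A‖ + ‖cexp (I * (θ : ℂ)) * ζ‖ := norm_add_le _ _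
    _ = ‖cexp (I * (θ : ℂ)) - 1‖ * ‖A‖ + ‖ζ‖ := by rw [norm_mul, norm_mul, n1, one_mul]
    _ ≤ (780 * π / ell D ^ 8) * 1.02 +
        (0.004 * (8 * |c'| * π ^ 2) + 520 * π * (3 / 2 + 8 * |c'| * π)) / ell D ^ 8 := by
        gcongr
        · exact n2.trans nθ
    _ = (1.02 * (780 * π) + (0.004 * (8 * |c'| * π ^ 2) + 520 * π * (3 / 2 + 8 * |c'| * π))) / ell D ^ 8 := by
        ring
    _ ≤ δ := hK

/-- **The exact weight `𝔴*_j` at `P^z` is within `10⁻⁵` of `wStarExact j z` on `[0.496, 0.5]` (`j = 1,2,3`)** once `𝓛 ≥ 1` and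
`K(c′)𝓛⁻⁸ ≤ 10⁻⁵`: `β₆ − β_j = iα((3/2 − j) + m_j c′α𝓛)`, `m_j = 5, −2, 3` ((2.13), (2.22)).
[cite: Zhang2022LandauSiegel, §12 p.68 (proof of Lemma 12.1), (12.16) p.73] -/
theorem wStarEx_sub_wStarExact_le (c' : ℝ) {D : ℕ} (hL1 : 1 ≤ ell D)
    (hK : (1.02 * (780 * π) + (0.004 * (8 * |c'| * π ^ 2) + 520 * π * (3 / 2 + 8 * |c'| * π))) / ell D ^ 8 ≤ 1e-5) :
    ∀ j ∈ ({1, 2, 3} : Finset ℕ), ∀ z ∈ Set.Icc (0.496 : ℝ) 0.5,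
      ‖((bigP D ^ z / P1pp D : ℝ) : ℂ) ^ (-beta6 D) *
            (-1 + (beta6 D - betaJ c' D j) * (Real.log (bigP D ^ z / P1pp D) : ℂ)) -
          wStarExact j z‖ ≤ 1e-5 := by
  intro j hj z hz
  simp only [Finset.mem_insert, Finset.mem_singleton] at hj
  rcases hj with rfl | rfl | rfl
  · have key : beta6 D - betaJ c' D 1 = I * alpha D * ((1 / 2 : ℝ) + (5 : ℝ) * c' * (alpha D * ell D)) := by
      norm_num only [betaJ, beta6, beta1, beta2, beta3]
      push_cast
      ring
    have h := exact_weight_bound hL1 hK key (by norm_num) (by norm_num) z hz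
    have e : wStarExact 1 z = -(cexp (-(3 * π * I * ((z : ℂ) - 0.496) / 2)) *
        (1 - ((1 / 2 : ℝ) : ℂ) * π * I * ((z : ℂ) - 0.496))) := by
      unfold Numerics.wStarExact; push_cast; ring
    rw [e]; exact h
  · have key : beta6 D - betaJ c' D 2 = I * alpha D * ((-1 / 2 : ℝ) + (-2 : ℝ) * c' * (alpha D * ell D)) := by
      norm_num only [betaJ, beta6, beta1, beta2, beta3]
      push_cast
      ring
    have h := exact_weight_bound hL1 hK key (by norm_num) (by norm_num) z hz
    have e : wStarExact 2 z = -(cexp (-(3 * π * I * ((z : ℂ) - 0.496) / 2)) *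
        (1 - ((-1 / 2 : ℝ) : ℂ) * π * I * ((z : ℂ) - 0.496))) := by
      unfold Numerics.wStarExact; push_cast; ring
    rw [e]; exact h
  · have key : beta6 D - betaJ c' D 3 = I * alpha D * ((-3 / 2 : ℝ) + (3 : ℝ) * c' * (alpha D * ell D)) := by
      norm_num only [betaJ, beta6, beta1, beta2, beta3]
      push_cast
      ring
    have h := exact_weight_bound hL1 hK key (by norm_num) (by norm_num) z hz
    have e : wStarExact 3 z = -(cexp (-(3 * π * I * ((z : ℂ) - 0.496) / 2)) *
        (1 - ((-3 / 2 : ℝ) : ℂ) * π * I * ((z : ℂ) - 0.496))) := by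
      unfold Numerics.wStarExact; push_cast; ring
    rw [e]; exact h

/-- The exact weight at `P^z` is continuous in `z` (for `𝓛 ≥ 1`: `P^z/P″₁ > 0`, `log(P^z/P″₁)` affine in `z`).
[cite: Zhang2022LandauSiegel, §12 p.68 (proof of Lemma 12.1)] -/
theorem continuous_wStarEx_rpow (c' : ℝ) {D : ℕ} (hL1 : 1 ≤ ell D) (j : ℕ) :
    Continuous fun z : ℝ => ((bigP D ^ z / P1pp D : ℝ) : ℂ) ^ (-beta6 D) *
      (-1 + (beta6 D - betaJ c' D j) * (Real.log (bigP D ^ z / P1pp D) : ℂ)) := by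
  have hx : ∀ z : ℝ, 0 < bigP D ^ z / P1pp D := fun z =>
    div_pos (Real.rpow_pos_of_pos (bigP_pos D) z) (P1pp_pos hL1)
  have e : (fun z : ℝ => ((bigP D ^ z / P1pp D : ℝ) : ℂ) ^ (-beta6 D) *
      (-1 + (beta6 D - betaJ c' D j) * (Real.log (bigP D ^ z / P1pp D) : ℂ))) = fun z : ℝ =>
      cexp ((((z - 0.496) * Real.log (bigP D) - ell D - 519 * Real.log (ell D) : ℝ) : ℂ) * (-beta6 D)) *
        (-1 + (beta6 D - betaJ c' D j) *
          (((z - 0.496) * Real.log (bigP D) - ell D - 519 * Real.log (ell D) : ℝ) : ℂ)) := by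
    funext z
    rw [Complex.cpow_def_of_ne_zero (Complex.ofReal_ne_zero.mpr (hx z).ne'), ← Complex.ofReal_log (hx z).le,
      log_rpow_div_P1pp hL1 z]
  rw [e]; fun_prop

end ExactWeight

/-! ## The window functional is `0.055`-Lipschitz in the sup-distance of the weights -/

section Functional

/-- **`‖e2starBarW w − e2starBarW w′‖ ≤ δ·0.055`** whenever `‖w_j − w′_j‖ ≤ δ` on `[0.496, 0.5]` (`j = 1,2,3`; both weight
families continuous): `∫‖𝔤𝔥_{jμ}‖`-bounds `nu_le` and `1/π`. [cite: Zhang2022LandauSiegel, §12 (12.16) p.73] -/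
theorem e2starBarW_sub_le_of_close {w w' : ℕ → ℝ → ℂ} {δ : ℝ} (hδ0 : 0 ≤ δ)
    (hw : ∀ j ∈ ({1, 2, 3} : Finset ℕ), Continuous (w j)) (hw' : ∀ j ∈ ({1, 2, 3} : Finset ℕ), Continuous (w' j))
    (hδ : ∀ j ∈ ({1, 2, 3} : Finset ℕ), ∀ z ∈ Set.Icc (0.496 : ℝ) 0.5, ‖w j z - w' j z‖ ≤ δ) :
    ‖e2starBarW w - e2starBarW w'‖ ≤ δ * 0.055 := by
  obtain ⟨n1, n2, n3⟩ := nu_le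
  -- window perturbation
  have pert : ∀ {a b : ℝ}, a ≤ b → b ≤ 0.5 → 0.496 ≤ a → ∀ {f : ℝ → ℂ}, Continuous f →
      ∀ j ∈ ({1, 2, 3} : Finset ℕ),
        ‖(∫ z in a..b, f z * w j z) - ∫ z in a..b, f z * w' j z‖ ≤ δ * ∫ z in a..b, ‖f z‖ := by
    intro a b hab hb ha f hf j hj
    have hi1 : IntervalIntegrable (fun z : ℝ => f z * w j z) MeasureTheory.volume a b :=
      (hf.mul (hw j hj)).intervalIntegrable _ _
    have hi2 : IntervalIntegrable (fun z : ℝ => f z * w' j z) MeasureTheory.volume a b :=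
      (hf.mul (hw' j hj)).intervalIntegrable _ _
    rw [← intervalIntegral.integral_sub hi1 hi2]
    have e : (fun z : ℝ => f z * w j z - f z * w' j z) = fun z : ℝ => f z * (w j z - w' j z) := by
      funext z; ring
    rw [e, ← intervalIntegral.integral_const_mul]
    refine intervalIntegral.norm_integral_le_of_norm_le hab ?_ ?_
    · refine Filter.Eventually.of_forall fun z hz => ?_
      rw [norm_mul, mul_comm]
      exact mul_le_mul_of_nonneg_right (hδ j hj z ⟨ha.trans hz.1.le, hz.2.trans hb⟩) (norm_nonneg _)
    · exact (Continuous.norm hf).intervalIntegrable _ _ |>.const_mul δ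
  have d6 : ∀ j ∈ ({1, 2, 3} : Finset ℕ), ‖J6 w j - J6 w' j‖ ≤
      δ * ∫ z in (0.496:ℝ)..0.498, ‖ghj j 6 (0.498 - z)‖ := by
    intro j hj
    have hj' := hj
    simp only [Finset.mem_insert, Finset.mem_singleton] at hj
    rcases hj with rfl | rfl | rfl
    · exact pert (by norm_num) (by norm_num) (by norm_num)
        ((continuous_ghF (8/3) (-5/3) (-1/2) (3/2)).comp (by fun_prop)) 1 hj'
    · exact pert (by norm_num) (by norm_num) (by norm_num)
        ((continuous_ghF (4/3) (-1/3) (1/2) (3/2)).comp (by fun_prop)) 2 hj'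
    · exact pert (by norm_num) (by norm_num) (by norm_num)
        ((continuous_ghF (8/9) (1/9) (1/6) (3/2)).comp (by fun_prop)) 3 hj'
  have d7 : ∀ j ∈ ({1, 2, 3} : Finset ℕ), ‖J7 w j - J7 w' j‖ ≤
      δ * ∫ z in (0.496:ℝ)..0.5, ‖ghj j 7 (0.5 - z)‖ := by
    intro j hj
    have hj' := hj
    simp only [Finset.mem_insert, Finset.mem_singleton] at hj
    rcases hj with rfl | rfl | rfl
    · exact pert (by norm_num) (by norm_num) (by norm_num)
        ((continuous_ghF (24/25) (1/25) (1/10) (5/2)).comp (by fun_prop)) 1 hj'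
    · exact pert (by norm_num) (by norm_num) (by norm_num)
        ((continuous_ghF (12/25) (13/25) (3/10) (5/2)).comp (by fun_prop)) 2 hj'
    · exact pert (by norm_num) (by norm_num) (by norm_num)
        ((continuous_ghF (8/25) (17/25) (-3/10) (5/2)).comp (by fun_prop)) 3 hj'
  have h61 := d6 1 (by simp); have h62 := d6 2 (by simp); have h63 := d6 3 (by simp)
  have h71 := d7 1 (by simp); have h72 := d7 2 (by simp); have h73 := d7 3 (by simp)
  set G61 := ∫ z in (0.496:ℝ)..0.498, ‖ghj 1 6 (0.498 - z)‖
  set G62 := ∫ z in (0.496:ℝ)..0.498, ‖ghj 2 6 (0.498 - z)‖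
  set G63 := ∫ z in (0.496:ℝ)..0.498, ‖ghj 3 6 (0.498 - z)‖
  set G71 := ∫ z in (0.496:ℝ)..0.5, ‖ghj 1 7 (0.5 - z)‖
  set G72 := ∫ z in (0.496:ℝ)..0.5, ‖ghj 2 7 (0.5 - z)‖
  set G73 := ∫ z in (0.496:ℝ)..0.5, ‖ghj 3 7 (0.5 - z)‖
  have e : e2starBarW w - e2starBarW w' = ((1 / (0.504 * π) : ℝ) : ℂ) *
      (1 / 2 * (iota3 * (J6 w 1 - J6 w' 1) / 0.498 + iota4 * (J7 w 1 - J7 w' 1) / 0.5)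
        + 2 * (iota3 * (J6 w 2 - J6 w' 2) / 0.498 + iota4 * (J7 w 2 - J7 w' 2) / 0.5)
        + 3 / 2 * (iota3 * (J6 w 3 - J6 w' 3) / 0.498 + iota4 * (J7 w 3 - J7 w' 3) / 0.5)) := by
    unfold e2starBarW; ring
  have hπ := Real.pi_pos
  have hc : ‖((1 / (0.504 * π) : ℝ) : ℂ)‖ = 1 / (0.504 * π) := by
    rw [Complex.norm_real, Real.norm_of_nonneg (by positivity)]
  have br : ∀ {X6 X7 : ℂ} {g6 g7 : ℝ}, ‖X6‖ ≤ δ * g6 → ‖X7‖ ≤ δ * g7 →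
      ‖iota3 * X6 / 0.498 + iota4 * X7 / 0.5‖ ≤
        δ * (0.504 * (‖iota3‖ / (0.504 * 0.498) * g6 + ‖iota4‖ / (0.504 * 0.5) * g7)) := by
    intro X6 X7 g6 g7 h6 h7
    have e1 : ‖iota3 * X6 / 0.498‖ = ‖iota3‖ * ‖X6‖ / 0.498 := by
      rw [norm_div, norm_mul]; norm_num
    have e2 : ‖iota4 * X7 / 0.5‖ = ‖iota4‖ * ‖X7‖ / 0.5 := by
      rw [norm_div, norm_mul]; norm_num
    calc ‖iota3 * X6 / 0.498 + iota4 * X7 / 0.5‖ ≤ ‖iota3 * X6 / 0.498‖ + ‖iota4 * X7 / 0.5‖ := norm_add_le _ _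
      _ = ‖iota3‖ * ‖X6‖ / 0.498 + ‖iota4‖ * ‖X7‖ / 0.5 := by rw [e1, e2]
      _ ≤ ‖iota3‖ * (δ * g6) / 0.498 + ‖iota4‖ * (δ * g7) / 0.5 := by gcongr
      _ = δ * (0.504 * (‖iota3‖ / (0.504 * 0.498) * g6 + ‖iota4‖ / (0.504 * 0.5) * g7)) := by
          field_simp
  have b1 := br h61 h71
  have b2 := br h62 h72
  have b3 := br h63 h73
  rw [e, norm_mul, hc]
  have hn3 := norm_add₃_le
    (a := 1 / 2 * (iota3 * (J6 w 1 - J6 w' 1) / 0.498 + iota4 * (J7 w 1 - J7 w' 1) / 0.5))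
    (b := 2 * (iota3 * (J6 w 2 - J6 w' 2) / 0.498 + iota4 * (J7 w 2 - J7 w' 2) / 0.5))
    (c := 3 / 2 * (iota3 * (J6 w 3 - J6 w' 3) / 0.498 + iota4 * (J7 w 3 - J7 w' 3) / 0.5))
  rw [norm_mul, norm_mul, norm_mul] at hn3
  have k1 : ‖(1 / 2 : ℂ)‖ = 1 / 2 := by norm_num
  have k2 : ‖(2 : ℂ)‖ = 2 := by norm_num
  have k3 : ‖(3 / 2 : ℂ)‖ = 3 / 2 := by norm_num
  rw [k1, k2, k3] at hn3
  have hin : 0 < 1 / (0.504 * π) := by positivity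
  calc 1 / (0.504 * π) * ‖1 / 2 * (iota3 * (J6 w 1 - J6 w' 1) / 0.498 + iota4 * (J7 w 1 - J7 w' 1) / 0.5)
        + 2 * (iota3 * (J6 w 2 - J6 w' 2) / 0.498 + iota4 * (J7 w 2 - J7 w' 2) / 0.5)
        + 3 / 2 * (iota3 * (J6 w 3 - J6 w' 3) / 0.498 + iota4 * (J7 w 3 - J7 w' 3) / 0.5)‖
      ≤ 1 / (0.504 * π) * (1 / 2 * (δ * (0.504 * 0.064)) + 2 * (δ * (0.504 * 0.042))
          + 3 / 2 * (δ * (0.504 * 0.037))) := by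
        apply mul_le_mul_of_nonneg_left _ hin.le
        refine hn3.trans ?_
        gcongr
        · exact b1.trans (by gcongr)
        · exact b2.trans (by gcongr)
        · exact b3.trans (by gcongr)
    _ = δ * (0.1715 / π) := by field_simp; ring
    _ ≤ δ * 0.055 := by
        apply mul_le_mul_of_nonneg_left _ hδ0
        rw [div_le_iff₀ Real.pi_pos]; nlinarith [Real.pi_gt_d2]

/-- **The weighted u049-shaped main terms equal `𝔞 · e2starBarW(w)`** for ANY weight family `w`: with the weights
`1/(2α), 2/α, 3/(2α)` of Proposition 7.1 and `α log P = π`. [cite: Zhang2022LandauSiegel, §12 (12.16) p.73] -/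
theorem weighted_window_eq {D : ℕ} [NeZero D] (χ : DirichletCharacter ℂ D) (hD : 1 ≤ Real.log D)
    (w : ℕ → ℝ → ℂ) :
    (1 / (2 * alpha D) *
          (frakA χ * iota3 / (0.504 * 0.498 * Real.log (bigP D)) *
              (∫ z in (0.496:ℝ)..0.498, ghj 1 6 (0.498 - z) * w 1 z) +
            frakA χ * iota4 / (0.504 * 0.5 * Real.log (bigP D)) *
              (∫ z in (0.496:ℝ)..0.5, ghj 1 7 (0.5 - z) * w 1 z)) +
        2 / alpha D *
          (frakA χ * iota3 / (0.504 * 0.498 * Real.log (bigP D)) *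
              (∫ z in (0.496:ℝ)..0.498, ghj 2 6 (0.498 - z) * w 2 z) +
            frakA χ * iota4 / (0.504 * 0.5 * Real.log (bigP D)) *
              (∫ z in (0.496:ℝ)..0.5, ghj 2 7 (0.5 - z) * w 2 z)) +
        3 / (2 * alpha D) *
          (frakA χ * iota3 / (0.504 * 0.498 * Real.log (bigP D)) *
              (∫ z in (0.496:ℝ)..0.498, ghj 3 6 (0.498 - z) * w 3 z) +
            frakA χ * iota4 / (0.504 * 0.5 * Real.log (bigP D)) *
              (∫ z in (0.496:ℝ)..0.5, ghj 3 7 (0.5 - z) * w 3 z)) : ℂ) =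
      frakA χ * e2starBarW w := by
  have hα0 : alpha D ≠ 0 := (alpha_pos_of_log hD).ne'
  have hα : (alpha D : ℂ) ≠ 0 := by exact_mod_cast hα0
  have hπ : (π : ℂ) ≠ 0 := by exact_mod_cast Real.pi_ne_zero
  have hlog : (Real.log (bigP D) : ℂ) = (π : ℂ) / (alpha D : ℂ) := by
    have h := alpha_mul_logP (D := D) hD
    have h' : ((alpha D : ℝ) : ℂ) * (Real.log (bigP D) : ℂ) = (π : ℂ) := by exact_mod_cast h
    field_simp; rw [mul_comm]; exact h'
  have e61 : (∫ z in (0.496:ℝ)..0.498, ghj 1 6 (0.498 - z) * w 1 z) = J6 w 1 := rfl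
  have e62 : (∫ z in (0.496:ℝ)..0.498, ghj 2 6 (0.498 - z) * w 2 z) = J6 w 2 := rfl
  have e63 : (∫ z in (0.496:ℝ)..0.498, ghj 3 6 (0.498 - z) * w 3 z) = J6 w 3 := rfl
  have e71 : (∫ z in (0.496:ℝ)..0.5, ghj 1 7 (0.5 - z) * w 1 z) = J7 w 1 := rfl
  have e72 : (∫ z in (0.496:ℝ)..0.5, ghj 2 7 (0.5 - z) * w 2 z) = J7 w 2 := rfl
  have e73 : (∫ z in (0.496:ℝ)..0.5, ghj 3 7 (0.5 - z) * w 3 z) = J7 w 3 := rfl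
  rw [e61, e62, e63, e71, e72, e73, hlog]
  unfold e2starBarW
  push_cast
  field_simp

end Functional

/-! ## (12.16) from the low range and an EXACT-weight evaluation of the top range -/

section Edge

variable (c' : ℝ)

/-- **(12.16) ⇐ "first sum `o(α)`" + the u049 second line with a weight family `w_D` that is eventually within `10⁻⁵`
of Zhang's exact main value `wStarExact`** (p. 73; this covers the exact-weight reading of record of the top range of
`S_j(𝐚₁₅,𝐚₂₂)` and the linear one alike): split `S_j = S_j|_{dr ≤ P″₁} + S_j|_{P″₁ < dr < P₂}` (`Sj_a15_split`),
weights of Proposition 7.1 against `α log P = π` (`weighted_window_eq`), the window functional's `0.055`-Lipschitz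
bound (`e2starBarW_sub_le_of_close`) and the kernel enclosure `‖e2starBarW wStarExact − conj e₂*‖ < 3.3·10⁻⁶`;
budget `3.3·10⁻⁶ + 10⁻⁵·0.055 = 3.85·10⁻⁶ ≤ 5·10⁻⁶`. [cite: Zhang2022LandauSiegel, §12 (12.16) p.73] -/
theorem eq1216_of_low1522_of_topEx (hLow : Low1522 c') (w : ℕ → ℕ → ℝ → ℂ)
    (hw : ForAllLarge fun D _ _ => ∀ j ∈ ({1, 2, 3} : Finset ℕ), Continuous (w D j) ∧
      ∀ z ∈ Set.Icc (0.496 : ℝ) 0.5, ‖w D j z - wStarExact j z‖ ≤ 1e-5)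
    (hTop : ∀ ε : ℝ, 0 < ε → ForAllLarge fun D _ χ => AssumptionA D χ →
      ∀ a15 : ℕ → ℂ, (∀ n, a15 n = χ (n : ZMod D) * vk13 D n) → ∀ j ∈ ({1, 2, 3} : Finset ℕ),
        ‖SjOn c' D j a15 (a22 χ) (rngTop D) -
            (frakA χ * iota3 / (0.504 * 0.498 * Real.log (bigP D)) *
                (∫ z in (0.496:ℝ)..0.498, ghj j 6 (0.498 - z) * w D j z) +
              frakA χ * iota4 / (0.504 * 0.5 * Real.log (bigP D)) *
                (∫ z in (0.496:ℝ)..0.5, ghj j 7 (0.5 - z) * w D j z))‖ ≤ ε * alpha D) :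
    Eq1216 c' := by
  intro ε hε
  set η := ε / 8 with hη
  have hη0 : 0 < η := by positivity
  obtain ⟨D₀, hall⟩ := (((hLow η hη0).and (hTop η hη0)).and hw).and (forAllLarge_log_ge 4)
  refine ⟨D₀, fun D _ χ hD hq hp hA a15 ha15 => ?_⟩
  obtain ⟨⟨⟨hLowD, hTopD⟩, hwD⟩, hlog4⟩ := hall D χ hD hq hp
  have hD1 : 1 ≤ Real.log D := by linarith
  have hα := alpha_pos_of_log (D := D) hD1
  have hAf := frakA_nonneg χ
  -- names
  set S : ℕ → ℂ := fun j => Sj c' D j a15 (a22 χ) with hS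
  set B : ℕ → ℂ := fun j => SjOn c' D j a15 (a22 χ) (rngBot D) with hB
  set T : ℕ → ℂ := fun j => SjOn c' D j a15 (a22 χ) (rngTop D) with hT
  set m : ℕ → ℂ := fun j => frakA χ * iota3 / (0.504 * 0.498 * Real.log (bigP D)) *
      (∫ z in (0.496:ℝ)..0.498, ghj j 6 (0.498 - z) * w D j z) +
    frakA χ * iota4 / (0.504 * 0.5 * Real.log (bigP D)) *
      (∫ z in (0.496:ℝ)..0.5, ghj j 7 (0.5 - z) * w D j z) with hm
  have hBj : ∀ j ∈ ({1, 2, 3} : Finset ℕ), ‖B j‖ ≤ η * alpha D := fun j hj => hLowD hA a15 ha15 j hj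
  have hTj : ∀ j ∈ ({1, 2, 3} : Finset ℕ), ‖T j - m j‖ ≤ η * alpha D := fun j hj => hTopD hA a15 ha15 j hj
  have hsplit : ∀ j, S j = B j + (T j - m j) + m j := fun j => by
    simp only [hS, hB, hT]; rw [Sj_a15_split c' χ hlog4 j a15]; ring
  have key : (1 / (2 * alpha D) * S 1 + 2 / alpha D * S 2 + 3 / (2 * alpha D) * S 3 : ℂ)
        - frakA χ * conj e2star
      = (1 / (2 * alpha D) * B 1 + 2 / alpha D * B 2 + 3 / (2 * alpha D) * B 3)
        + (1 / (2 * alpha D) * (T 1 - m 1) + 2 / alpha D * (T 2 - m 2) + 3 / (2 * alpha D) * (T 3 - m 3))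
        + ((1 / (2 * alpha D) * m 1 + 2 / alpha D * m 2 + 3 / (2 * alpha D) * m 3) - frakA χ * conj e2star) := by
    rw [hsplit 1, hsplit 2, hsplit 3]; ring
  have hmain : (1 / (2 * alpha D) * m 1 + 2 / alpha D * m 2 + 3 / (2 * alpha D) * m 3 : ℂ) =
      frakA χ * e2starBarW (w D) := weighted_window_eq χ hD1 (w D)
  have hwin : ‖e2starBarW (w D) - conj e2star‖ ≤ 1e-5 * 0.055 + 33 / 10 ^ 7 := by
    have h1 : ‖e2starBarW (w D) - e2starBarW wStarExact‖ ≤ 1e-5 * 0.055 :=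
      e2starBarW_sub_le_of_close (by norm_num) (fun j hj => (hwD j hj).1)
        (fun j _ => by unfold Numerics.wStarExact; fun_prop) (fun j hj => (hwD j hj).2)
    have h2 := norm_e2starBarW_exact_sub_lt
    have e : e2starBarW (w D) - conj e2star =
        (e2starBarW (w D) - e2starBarW wStarExact) + (e2starBarW wStarExact - conj e2star) := by ring
    rw [e]
    exact (norm_add_le _ _).trans (by linarith)
  have g1 : ‖(1 / (2 * alpha D) * B 1 + 2 / alpha D * B 2 + 3 / (2 * alpha D) * B 3 : ℂ)‖ ≤ 4 * η := by
    refine (norm_weighted_le hα (hBj 1 (by simp)) (hBj 2 (by simp)) (hBj 3 (by simp))).trans (le_of_eq ?_)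
    field_simp; ring
  have g2 : ‖(1 / (2 * alpha D) * (T 1 - m 1) + 2 / alpha D * (T 2 - m 2) +
      3 / (2 * alpha D) * (T 3 - m 3) : ℂ)‖ ≤ 4 * η := by
    refine (norm_weighted_le hα (hTj 1 (by simp)) (hTj 2 (by simp)) (hTj 3 (by simp))).trans (le_of_eq ?_)
    field_simp; ring
  have g3 : ‖(1 / (2 * alpha D) * m 1 + 2 / alpha D * m 2 + 3 / (2 * alpha D) * m 3 : ℂ)
      - frakA χ * conj e2star‖ ≤ frakA χ * (1e-5 * 0.055 + 33 / 10 ^ 7) := by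
    rw [hmain, ← mul_sub, norm_mul, Complex.norm_real, Real.norm_of_nonneg hAf]
    exact mul_le_mul_of_nonneg_left hwin hAf
  rw [key]
  calc ‖(1 / (2 * alpha D) * B 1 + 2 / alpha D * B 2 + 3 / (2 * alpha D) * B 3)
        + (1 / (2 * alpha D) * (T 1 - m 1) + 2 / alpha D * (T 2 - m 2) + 3 / (2 * alpha D) * (T 3 - m 3))
        + ((1 / (2 * alpha D) * m 1 + 2 / alpha D * m 2 + 3 / (2 * alpha D) * m 3) - frakA χ * conj e2star)‖
      ≤ ‖(1 / (2 * alpha D) * B 1 + 2 / alpha D * B 2 + 3 / (2 * alpha D) * B 3 : ℂ)‖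
        + ‖(1 / (2 * alpha D) * (T 1 - m 1) + 2 / alpha D * (T 2 - m 2) + 3 / (2 * alpha D) * (T 3 - m 3) : ℂ)‖
        + ‖(1 / (2 * alpha D) * m 1 + 2 / alpha D * m 2 + 3 / (2 * alpha D) * m 3 : ℂ)
            - frakA χ * conj e2star‖ := norm_add₃_le
    _ ≤ 4 * η + 4 * η + frakA χ * (1e-5 * 0.055 + 33 / 10 ^ 7) := by gcongr
    _ = frakA χ * (1e-5 * 0.055 + 33 / 10 ^ 7) + ε := by rw [hη]; ring
    _ ≤ frakA χ * (1e-5 / 2) + ε := by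
        have : (1e-5 * 0.055 + 33 / 10 ^ 7 : ℝ) ≤ 1e-5 / 2 := by norm_num
        nlinarith

/-- **(12.16) from `Low1522` and the u049 second line with the EXACT weight written as in §12.u020**: the top-range
hypothesis is `‖S_j|_{P″₁<dr<P₂}(𝐚₁₅,𝐚₂₂) − [𝔞ι₃/((0.504)(0.498)log P)∫_{0.496}^{0.498}𝔤𝔥_{j6}(0.498−z)𝔴*_j(P^z)dz +
𝔞ι₄/((0.504)(0.5)log P)∫_{0.496}^{0.5}𝔤𝔥_{j7}(0.5−z)𝔴*_j(P^z)dz]‖ ≤ εα` with `𝔴*_j(y) = (y/P″₁)^{−β₆}(−1 + (β₆ − β_j)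
log(y/P″₁))` — the exact-weight (`o(α)`, slack-free) reading of the printed sentence "By lemma 8.2, 8.3 and 12.3, the sum
over `P″₁ < dr < P₂` is equal to …" (p. 73). [cite: Zhang2022LandauSiegel, §12 (12.16) p.73] -/
theorem eq1216_of_low1522_top1522Ex_shape (hLow : Low1522 c')
    (hTop : ∀ ε : ℝ, 0 < ε → ForAllLarge fun D _ χ => AssumptionA D χ →
      ∀ a15 : ℕ → ℂ, (∀ n, a15 n = χ (n : ZMod D) * vk13 D n) → ∀ j ∈ ({1, 2, 3} : Finset ℕ),
        ‖SjOn c' D j a15 (a22 χ) (rngTop D) -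
            (frakA χ * iota3 / (0.504 * 0.498 * Real.log (bigP D)) *
                (∫ z in (0.496:ℝ)..0.498, ghj j 6 (0.498 - z) *
                  (((bigP D ^ z / P1pp D : ℝ) : ℂ) ^ (-beta6 D) *
                    (-1 + (beta6 D - betaJ c' D j) * (Real.log (bigP D ^ z / P1pp D) : ℂ)))) +
              frakA χ * iota4 / (0.504 * 0.5 * Real.log (bigP D)) *
                (∫ z in (0.496:ℝ)..0.5, ghj j 7 (0.5 - z) *
                  (((bigP D ^ z / P1pp D : ℝ) : ℂ) ^ (-beta6 D) *
                    (-1 + (beta6 D - betaJ c' D j) * (Real.log (bigP D ^ z / P1pp D) : ℂ)))))‖ ≤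
          ε * alpha D) :
    Eq1216 c' := by
  obtain ⟨D₁, hD₁⟩ := ell_large
    (1.02 * (780 * π) + (0.004 * (8 * |c'| * π ^ 2) + 520 * π * (3 / 2 + 8 * |c'| * π))) 1e-5
    (by positivity) (by norm_num)
  refine eq1216_of_low1522_of_topEx c' hLow
    (fun D j z => ((bigP D ^ z / P1pp D : ℝ) : ℂ) ^ (-beta6 D) *
      (-1 + (beta6 D - betaJ c' D j) * (Real.log (bigP D ^ z / P1pp D) : ℂ)))
    ⟨D₁, fun D _ _ hD _ _ j hj => ?_⟩ hTop
  obtain ⟨hL1, hK⟩ := hD₁ D hD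
  exact ⟨continuous_wStarEx_rpow c' hL1 j, wStarEx_sub_wStarExact_le c' hL1 hK j hj⟩

end Edge

end Literature.NumberTheory.LFunctions.Zhang2022.Sec12D
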